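import Summits.BirchSwinnertonDyer.BirchSwinnertonDyer.Theorems.TeichmullerTwistDescentKOfPrincipalSeriesFunctional
import Literature.NumberTheory.EllipticCurves.ModularJacobianMultiplicityOneCosocleProofs
import HarnessLib

/-!
# Route `TeichmullerTwistDescent`, crux K `TwistedPeriodLatticeSaturation` (stmt-BirchSwinnertonDyer-25368):
# K from modularity, a nonzero equivariant map to the tame principal series over `ℚ_p` (I1ℚ) or over ANY field `K ⊇ ℚ_p`
# (I1ᴷ), and the weight exclusion (W‴) — `Λ_Q(f)` is finitely generated, denominators clear, and the Bruhat model is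
# defined over `ℤ_p`

Cell `pub/bsd-wall` (D-0145 line route-BirchSwinnertonDyer-TeichmullerTwistDescent, OPEN rev 7), seat `bsd-line-ttd-p1`
(prover 1/2, g26).  THEOREMS ONLY (no definition, no named fact, no `sorry`); `--supports stmt-BirchSwinnertonDyer-25368`.  BSD is not proved by this file; K is NOT proved by this file (it
stays CONDITIONAL); nothing here closes an item.

WHAT.  (I1⁰) `TamePrincipalSeriesFunctional` asks for an INTEGRAL (`ℤ_p`-valued) nonzero equivariant map out of the K-line
lattice `Λ_Q(f_D)`; every characteristic-zero source (Eichler–Shimura at level `K(p)K₀(M)`, Casselman's `K(p)`-invariants,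
local Langlands at `p`) produces a `ℚ_p`-valued one — the input (I1ℚ) `TamePrincipalSeriesFunctionalRat`
(`TeichmullerTwistDescentCarrierDefs`, appended g26).  Here the denominators are cleared:

* `moduleFinite_periodLattice` — `Λ_f` is a finitely generated `ℤ`-module (image of `H₁(X₀(N), ℤ)`, tree
  `moduleFinite_int_periodHomologyHecke` + `periodMapLattice_surjective`);
* **`moduleFinite_spreadLattice`** — `Λ_Q(f) ⊆ Fun(GL₂(ℤ/p), ℤ_p ⊗ Λ_f)` is a finitely generated `ℤ_p`-module (`ℤ_p` Noetherian);
* `exists_smul_isInteger` — a `ℤ_p`-linear map from a finitely generated module to `ℚ_p`-valued coordinate vectors is integral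
  after multiplication by some nonzero `b ∈ ℤ_p` (common denominator of the images of generators,
  `IsLocalization.exist_integer_multiples_of_finite`); `exists_integral_of_smul_isInteger` — the resulting `ℤ_p`-valued map
  `Ψ'` with `coordReduce ℚ_p (Ψ' x) = b • Ψ x`; `coordReduce_padic_injective`;
* `compLeft_coordRep` — **the Bruhat model is defined over `ℤ_p`**: for any field `K` over `ℚ_p` and any `ℚ_p`-linear
  `θ : K → ℚ_p`, applying `θ` coordinatewise commutes with `coordRep g` (its matrix has entries in `ℤ_p`, `coordReduce_coordRep`);
  `exists_rat_of_field` — a nonzero equivariant `K`-valued map descends to a nonzero equivariant `ℚ_p`-valued one (compose with a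
  functional not killing a chosen nonzero coordinate, `Module.Projective.exists_dual_ne_zero`);
* **`tamePrincipalSeriesFunctional_of_rat : I1ℚ → I1⁰`** (equivariance transported along the injective `coordReduce ℚ_p` by
  `coordReduce_coordRep`), `tamePrincipalSeriesFunctionalRat_of_integral : I1⁰ → I1ℚ` (extend scalars),
  **`tamePrincipalSeriesFunctionalRat_of_field : I1ᴷ → I1ℚ`**, `tamePrincipalSeriesFunctionalOverField_of_rat : I1ℚ → I1ᴷ`, hence
  **`tamePrincipalSeriesFunctionalRat_iff`, `tamePrincipalSeriesFunctionalOverField_iff`: I1ᴷ ↔ I1ℚ ↔ I1⁰**, and the closures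
  **`twistedPeriodLatticeSaturation_of_rat_of_noEtaleWeightEigenQuotient (hnf) (hrat) (hW) : K`**,
  **`twistedPeriodLatticeSaturation_of_field_of_noEtaleWeightEigenQuotient (hnf) (hK) (hW) : K`** (route decl verbatim),
  `ordinaryLowValuationOptimalManinUnitGeEleven_of_rat_inputs` / `…_of_field_inputs` (GE11 certificates).

STATE OF THE K-LINE (g26): K ⟸ `exists_isNewformOf` ∧ (I1ᴷ) ∧ (W‴), with (I1ᴷ) ⟺ (I1ℚ) ⟺ (I1⁰) ⟺ (I1‴) the purely geometric
statement «`Hom_{GL₂(𝔽_p)}(Λ_Q(f_W) ⊗ K, Ind(ω̃^{−b} ⊗ ω̃ᵇ)_K) ≠ 0` for some field `K ⊇ ℚ_p` (e.g. `ℚ̄_p`)».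
[cite: AshStevens1986, §1 (1.2)–(1.3)]
[cite: CremonaAlgorithms1997, §2.10] [cite: SerreLinearRepresentations1977, §15.2] [cite: EdixhovenManin1991, §4]
-/

set_option autoImplicit false
-- single-conjunct summit: `Summit.BirchSwinnertonDyer.BirchSwinnertonDyer.…` repeats the name by design
set_option linter.dupNamespace false

noncomputable section

open scoped Pointwise MatrixGroups TensorProduct

open Function CongruenceSubgroup
open Literature.RepresentationTheory.FiniteGroups Literature.RepresentationTheory.FiniteGroups.GL2
  Literature.NumberTheory.EllipticCurves.ModularForms
open Literature.NumberTheory.EllipticCurves (Kato2004.teichmullerChar)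
open Literature.NumberTheory.ModularSymbols Literature.NumberTheory.ModularSymbols.FullLevel
open Literature.Algebra.Homology
open Literature.NumberTheory.Automorphic (TwistedQuotient.resScalars TwistedQuotient.resScalars_apply)

namespace Summit.BirchSwinnertonDyer.BirchSwinnertonDyer.Theorems.TeichmullerTwistDescent

open WeierstrassCurve Literature.NumberTheory.EllipticCurves
open Summit.BirchSwinnertonDyer.BirchSwinnertonDyer.Theses.TeichmullerTwistDescent

namespace KOfPrincipalSeriesFunctional

/-! ### Finite generation of `Λ_f` and `Λ_Q(f)` -/

section Finiteness

variable (p M : ℕ) [Fact p.Prime] [NeZero M] (hpM : Nat.Coprime p M)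
  [Fintype (diagTorus (ZMod p))] [Invertible (Fintype.card (diagTorus (ZMod p)) : ℤ_[p])]

/-- The period lattice `Λ_f` of a weight-two cusp form is a finitely generated `ℤ`-module (it is the image of
`H₁(X₀(N), ℤ)` under the period map). [cite: CremonaAlgorithms1997, §2.10] -/
theorem moduleFinite_periodLattice (N : ℕ) [NeZero N] (f : CuspForm (Gamma0 N) 2) :
    Module.Finite ℤ (periodLattice f).toIntSubmodule := by
  haveI := moduleFinite_int_periodHomologyHecke N
  exact Module.Finite.of_surjective (periodMapLattice N f) (periodMapLattice_surjective N f)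

/-- **The K-line lattice `Λ_Q(f)` is a finitely generated `ℤ_p`-module**: a submodule of the finitely generated module
`Fun(GL₂(ℤ/p), ℤ_p ⊗ Λ_f)` over the Noetherian ring `ℤ_p`. [cite: AshStevens1986, §1 (1.3)] -/
theorem moduleFinite_spreadLattice (f : CuspForm (Gamma0 (p ^ 2 * M)) 2) :
    Module.Finite ℤ_[p] (spreadLattice ℤ_[p] p M hpM f) := by
  haveI : NeZero (p ^ 2 * M) := neZero_sq_mul p M
  haveI := moduleFinite_periodLattice (p ^ 2 * M) f
  haveI : IsNoetherian ℤ_[p] (GL (Fin 2) (ZMod p) → ℤ_[p] ⊗[ℤ] (periodLattice f).toIntSubmodule) :=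
    isNoetherian_of_isNoetherianRing_of_finite ℤ_[p] _
  exact Module.Finite.iff_fg.mpr (IsNoetherian.noetherian _)

end Finiteness

/-! ### Clearing denominators: `ℚ_p`-valued linear maps on finitely generated `ℤ_p`-modules -/

section Scaling

variable (p : ℕ) [Fact p.Prime]

/-- **Common denominator**: for a `ℤ_p`-linear map `Ψ` from a finitely generated `ℤ_p`-module to `ℚ_p`-valued coordinate
vectors there is a nonzero `b ∈ ℤ_p` with all `b • Ψ x i ∈ ℤ_p` (clear the denominators of the images of a finite generating
set). [cite: SerreLinearRepresentations1977, §15.2] -/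
theorem exists_smul_isInteger {Λ : Type} [AddCommGroup Λ] [Module ℤ_[p] Λ] [Module.Finite ℤ_[p] Λ] {ι : Type} [Finite ι]
    (Ψ : Λ →ₗ[ℤ_[p]] (ι → ℚ_[p])) :
    ∃ b : ℤ_[p], b ≠ 0 ∧ ∀ (x : Λ) (i : ι), IsLocalization.IsInteger ℤ_[p] ((b : ℤ_[p]) • Ψ x i) := by
  obtain ⟨s, hs⟩ := Module.Finite.fg_top (R := ℤ_[p]) (M := Λ)
  obtain ⟨b, hb⟩ := IsLocalization.exist_integer_multiples_of_finite (nonZeroDivisors ℤ_[p])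
    (fun ix : s × ι => Ψ ix.1 ix.2)
  refine ⟨b, nonZeroDivisors.coe_ne_zero b, fun x => ?_⟩
  have hx : x ∈ Submodule.span ℤ_[p] (s : Set Λ) := by rw [hs]; exact Submodule.mem_top
  induction hx using Submodule.span_induction with
  | mem y hy => exact fun i => hb (⟨y, hy⟩, i)
  | zero => intro i; rw [map_zero, Pi.zero_apply, smul_zero]; exact IsLocalization.isInteger_zero
  | add y z _ _ hy hz =>
    intro i
    rw [map_add, Pi.add_apply, smul_add]
    exact IsLocalization.isInteger_add (hy i) (hz i)
  | smul c y _ hy =>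
    intro i
    rw [map_smul, Pi.smul_apply, smul_comm]
    exact IsLocalization.isInteger_smul (hy i)

/-- An element of `ℚ_p` in the image of `ℤ_p` has norm `≤ 1`. [cite: SerreLinearRepresentations1977, §15.2] -/
theorem norm_le_one_of_isInteger {x : ℚ_[p]} (hx : IsLocalization.IsInteger ℤ_[p] x) : ‖x‖ ≤ 1 := by
  obtain ⟨y, rfl⟩ := hx
  exact PadicInt.norm_le_one y

/-- **The integral multiple of a rational map**: if every `b • Ψ x i` lies in `ℤ_p`, there is a `ℤ_p`-valued `ℤ_p`-linear map
`Ψ'` with `ℚ_p`-coordinates `b • Ψ x` (`coordReduce ℚ_p (Ψ' x) = b • Ψ x`). [cite: SerreLinearRepresentations1977, §15.2] -/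
theorem exists_integral_of_smul_isInteger {Λ : Type} [AddCommGroup Λ] [Module ℤ_[p] Λ]
    (Ψ : Λ →ₗ[ℤ_[p]] (Option (ZMod p) → ℚ_[p])) (b : ℤ_[p])
    (hb : ∀ (x : Λ) (i : Option (ZMod p)), IsLocalization.IsInteger ℤ_[p] (b • Ψ x i)) :
    ∃ Ψ' : Λ →ₗ[ℤ_[p]] (Option (ZMod p) → ℤ_[p]), ∀ x, coordReduce ℚ_[p] (Ψ' x) = b • Ψ x := by
  refine ⟨{ toFun := fun x i => ⟨b • Ψ x i, norm_le_one_of_isInteger p (hb x i)⟩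
            map_add' := fun x y => ?_
            map_smul' := fun c x => ?_ }, fun x => ?_⟩
  · funext i
    apply PadicInt.ext
    change b • Ψ (x + y) i = b • Ψ x i + b • Ψ y i
    rw [map_add, Pi.add_apply, smul_add]
  · funext i
    apply PadicInt.ext
    change b • Ψ (c • x) i = ((c * ⟨b • Ψ x i, norm_le_one_of_isInteger p (hb x i)⟩ : ℤ_[p]) : ℚ_[p])
    rw [map_smul, Pi.smul_apply, PadicInt.coe_mul, smul_comm, Algebra.smul_def, PadicInt.algebraMap_apply]
  · funext o
    rw [coordReduce_apply, PadicInt.algebraMap_apply, Pi.smul_apply]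
    rfl

/-- Extension of scalars `ℤ_p → ℚ_p` on Bruhat coordinates is injective. [cite: SerreLinearRepresentations1977, §15.2] -/
theorem coordReduce_padic_injective : Function.Injective (coordReduce (p := p) (R := ℤ_[p]) ℚ_[p]) := by
  intro v w h
  funext o
  have := congr_fun h o
  rw [coordReduce_apply, coordReduce_apply, PadicInt.algebraMap_apply, PadicInt.algebraMap_apply] at this
  exact PadicInt.ext this

end Scaling

/-! ### Descent from a field `K ⊇ ℚ_p` to `ℚ_p`: the Bruhat model is defined over `ℤ_p` -/

section Descent

variable (p : ℕ) [Fact p.Prime] {K : Type} [Field K] [Algebra ℤ_[p] K] [Algebra ℚ_[p] K] [IsScalarTower ℤ_[p] ℚ_[p] K]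

omit [Fact (Nat.Prime p)] in
/-- Change of coefficients fixes the coordinate vectors `δ_{o'}`. [cite: SerreLinearRepresentations1977, §15.2] -/
theorem coordReduce_single {R : Type} [CommRing R] {k : Type} [CommRing k] [Algebra R k] (o' : Option (ZMod p)) :
    coordReduce (p := p) (R := R) k (Pi.single o' 1) = Pi.single o' 1 := by
  funext o
  rw [coordReduce_apply, Pi.single_apply, Pi.single_apply, apply_ite (algebraMap R k), map_one, map_zero]

/-- **The Bruhat model is defined over `ℤ_p`**: applying a `ℚ_p`-linear functional `θ : K → ℚ_p` coordinatewise commutes with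
the group action (`coordRep` over `K` versus over `ℚ_p`, both with the characters pushed forward from `ℤ_p`): the matrix of
`coordRep g` in the coordinate basis has entries in `ℤ_p` (`coordReduce_coordRep`). [cite: SerreLinearRepresentations1977, §15.2]
[cite: Bump1997, §4.1 Eq. (1.6)–(1.7)] -/
theorem compLeft_coordRep (χ₁ χ₂ : (ZMod p)ˣ →* ℤ_[p]ˣ) (θ : K →ₗ[ℚ_[p]] ℚ_[p]) (g : GL (Fin 2) (ZMod p))
    (v : Option (ZMod p) → K) :
    (fun o => θ (coordRep (reduceChar K χ₁) (reduceChar K χ₂) g v o)) =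
      coordRep (reduceChar ℚ_[p] χ₁) (reduceChar ℚ_[p] χ₂) g (fun o => θ (v o)) := by
  -- both sides are `ℚ_p`-linear in `v`; compare them on the vectors `Pi.single o' x`
  let L : (Option (ZMod p) → K) →ₗ[ℚ_[p]] (Option (ZMod p) → ℚ_[p]) :=
    (θ.compLeft (Option (ZMod p))).comp ((coordRep (reduceChar K χ₁) (reduceChar K χ₂) g).restrictScalars ℚ_[p])
  let Rm : (Option (ZMod p) → K) →ₗ[ℚ_[p]] (Option (ZMod p) → ℚ_[p]) :=
    ((coordRep (reduceChar ℚ_[p] χ₁) (reduceChar ℚ_[p] χ₂) g).restrictScalars ℚ_[p]).comp (θ.compLeft (Option (ZMod p)))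
  have hLR : L = Rm := by
    apply LinearMap.pi_ext
    intro o' x
    -- `Pi.single o' x = x • coordReduce K (δ_{o'})`, `θ ∘ Pi.single o' x = θ x • coordReduce ℚ_p (δ_{o'})`
    have h1 : (Pi.single o' x : Option (ZMod p) → K) = x • coordReduce (p := p) (R := ℤ_[p]) K (Pi.single o' 1) := by
      rw [coordReduce_single]; funext o; rw [Pi.smul_apply, Pi.single_apply, Pi.single_apply, smul_ite, smul_eq_mul, mul_one,
        smul_zero]
    have h2 : (fun o => θ ((Pi.single o' x : Option (ZMod p) → K) o)) =
        θ x • coordReduce (p := p) (R := ℤ_[p]) ℚ_[p] (Pi.single o' 1) := by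
      rw [coordReduce_single]; funext o
      rw [Pi.smul_apply, Pi.single_apply, Pi.single_apply, apply_ite θ, map_zero, smul_ite, smul_eq_mul, mul_one, smul_zero]
    change (fun o => θ (coordRep (reduceChar K χ₁) (reduceChar K χ₂) g (Pi.single o' x) o)) =
      coordRep (reduceChar ℚ_[p] χ₁) (reduceChar ℚ_[p] χ₂) g (fun o => θ ((Pi.single o' x : Option (ZMod p) → K) o))
    rw [h2, h1, map_smul, map_smul, ← coordReduce_coordRep, ← coordReduce_coordRep]
    funext o
    rw [Pi.smul_apply, Pi.smul_apply, coordReduce_apply, coordReduce_apply, PadicInt.algebraMap_apply, smul_eq_mul,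
      smul_eq_mul, IsScalarTower.algebraMap_apply ℤ_[p] ℚ_[p] K, PadicInt.algebraMap_apply, mul_comm x,
      ← Algebra.smul_def, LinearMap.map_smul, smul_eq_mul, mul_comm]
  have := LinearMap.congr_fun hLR v
  simp only [L, Rm, LinearMap.comp_apply, LinearMap.restrictScalars_apply] at this
  exact this

end Descent

/-- **Descent of a nonzero equivariant map from a field `K ⊇ ℚ_p` to `ℚ_p`**: compose with a `ℚ_p`-linear functional
`θ : K → ℚ_p` that does not kill a chosen nonzero coordinate (`Module.Projective.exists_dual_ne_zero`); equivariance is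
`compLeft_coordRep`. [cite: SerreLinearRepresentations1977, §15.2] -/
theorem exists_rat_of_field (p M : ℕ) [Fact p.Prime] [NeZero M] (hpM : Nat.Coprime p M)
    [Fintype (diagTorus (ZMod p))] [Invertible (Fintype.card (diagTorus (ZMod p)) : ℤ_[p])]
    (f : CuspForm (Gamma0 (p ^ 2 * M)) 2) (χ₁ χ₂ : (ZMod p)ˣ →* ℤ_[p]ˣ)
    {K : Type} [Field K] [Algebra ℤ_[p] K] [Algebra ℚ_[p] K] [IsScalarTower ℤ_[p] ℚ_[p] K]
    (ΨK : spreadLattice ℤ_[p] p M hpM f →ₗ[ℤ_[p]] (Option (ZMod p) → K))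
    (hΨK : IsEquivariantOnSpread ℤ_[p] p M hpM f
      (TwistedQuotient.resScalars ℤ_[p] (coordRep (reduceChar K χ₁) (reduceChar K χ₂))) ΨK)
    (hΨK0 : ΨK ≠ 0) :
    ∃ Ψ : spreadLattice ℤ_[p] p M hpM f →ₗ[ℤ_[p]] (Option (ZMod p) → ℚ_[p]),
      IsEquivariantOnSpread ℤ_[p] p M hpM f
        (TwistedQuotient.resScalars ℤ_[p] (coordRep (reduceChar ℚ_[p] χ₁) (reduceChar ℚ_[p] χ₂))) Ψ ∧ Ψ ≠ 0 := by
  -- a nonzero coordinate and a functional seeing it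
  obtain ⟨F₀, hF₀⟩ : ∃ F, ΨK F ≠ 0 := by
    by_contra h
    push Not at h
    exact hΨK0 (LinearMap.ext fun F => by rw [h F, LinearMap.zero_apply])
  obtain ⟨o₀, ho₀⟩ : ∃ o, ΨK F₀ o ≠ 0 := by
    by_contra h
    push Not at h
    exact hF₀ (funext h)
  obtain ⟨θ, hθ⟩ := Module.Projective.exists_dual_ne_zero ℚ_[p] ho₀
  refine ⟨((θ.restrictScalars ℤ_[p]).compLeft (Option (ZMod p))).comp ΨK, ?_, ?_⟩
  · intro F g
    rw [LinearMap.comp_apply, LinearMap.comp_apply, hΨK F g, TwistedQuotient.resScalars_apply,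
      TwistedQuotient.resScalars_apply]
    exact compLeft_coordRep p χ₁ χ₂ θ g (ΨK F)
  · intro h0
    apply hθ
    have := congr_fun (LinearMap.congr_fun h0 F₀) o₀
    simpa using this

/-! ### (I1ᴷ) ⟺ (I1ℚ) ⟺ (I1⁰), and K / GE11 from the rational inputs -/

/-- **(I1ᴷ) ⟹ (I1ℚ)**: descend from the field `K` to `ℚ_p` (`exists_rat_of_field`).  BSD is not proved by this.
[cite: SerreLinearRepresentations1977, §15.2] -/
theorem tamePrincipalSeriesFunctionalRat_of_field (hK : TamePrincipalSeriesFunctionalOverField) :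
    TamePrincipalSeriesFunctionalRat := by
  intro p M _ _ _ hpM _ _ W _ _ hN D hp11 hadd hirr hGo hV4
  obtain ⟨K, _, _, _, _, ΨK, hΨK, hΨK0⟩ := hK p M hpM W hN D hp11 hadd hirr hGo hV4
  exact exists_rat_of_field p M hpM D.f _ _ ΨK hΨK hΨK0

/-- **(I1ℚ) ⟹ (I1ᴷ)**: take `K = ℚ_p`.  BSD is not proved by this. [cite: SerreLinearRepresentations1977, §15.2] -/
theorem tamePrincipalSeriesFunctionalOverField_of_rat (hrat : TamePrincipalSeriesFunctionalRat) :
    TamePrincipalSeriesFunctionalOverField := by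
  intro p M _ _ _ hpM _ _ W _ _ hN D hp11 hadd hirr hGo hV4
  obtain ⟨Ψ, hΨ, hΨ0⟩ := hrat p M hpM W hN D hp11 hadd hirr hGo hV4
  exact ⟨ℚ_[p], inferInstance, inferInstance, inferInstance, inferInstance, Ψ, hΨ, hΨ0⟩

/-- **(I1ℚ) ⟹ (I1⁰)**: clear denominators.  A nonzero equivariant `ℚ_p`-valued `Ψ` on the finitely generated `Λ_Q(f_D)`
becomes, after multiplication by a nonzero `b ∈ ℤ_p`, an integral nonzero map, equivariant for the integral model because
`coordReduce ℚ_p` is injective and intertwines (`coordReduce_coordRep`).  BSD is not proved by this.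
[cite: SerreLinearRepresentations1977, §15.2] [cite: AshStevens1986, §1 (1.3)] -/
theorem tamePrincipalSeriesFunctional_of_rat (hrat : TamePrincipalSeriesFunctionalRat) : TamePrincipalSeriesFunctional := by
  intro p M _ _ _ hpM _ _ W _ _ hN D hp11 hadd hirr hGo hV4
  obtain ⟨Ψ, hΨ, hΨ0⟩ := hrat p M hpM W hN D hp11 hadd hirr hGo hV4
  haveI := moduleFinite_spreadLattice p M hpM D.f
  obtain ⟨b, hb0, hb⟩ := exists_smul_isInteger p Ψ
  obtain ⟨Ψ', hΨ'⟩ := exists_integral_of_smul_isInteger p Ψ b hb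
  refine ⟨Ψ', ?_, ?_⟩
  · intro F g
    apply coordReduce_padic_injective p
    rw [hΨ', coordReduce_coordRep, hΨ', hΨ F g, TwistedQuotient.resScalars_apply, LinearMap.map_smul_of_tower]
  · intro h0
    apply hΨ0
    ext F o
    have h1 : (b • Ψ F) o = 0 := by
      rw [← hΨ', h0, LinearMap.zero_apply, map_zero, Pi.zero_apply]
    rw [Pi.smul_apply, Algebra.smul_def, PadicInt.algebraMap_apply, mul_eq_zero] at h1
    rcases h1 with h1 | h1
    · exact absurd (PadicInt.coe_eq_zero.mp h1) hb0
    · rw [h1, LinearMap.zero_apply, Pi.zero_apply]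

/-- **(I1⁰) ⟹ (I1ℚ)**: extend scalars along `ℤ_p → ℚ_p` (`coordReduce ℚ_p`, injective and intertwining).  BSD is not proved
by this. [cite: SerreLinearRepresentations1977, §15.2] -/
theorem tamePrincipalSeriesFunctionalRat_of_integral (hPS : TamePrincipalSeriesFunctional) :
    TamePrincipalSeriesFunctionalRat := by
  intro p M _ _ _ hpM _ _ W _ _ hN D hp11 hadd hirr hGo hV4
  obtain ⟨Ψ, hΨ, hΨ0⟩ := hPS p M hpM W hN D hp11 hadd hirr hGo hV4
  refine ⟨(coordReduce (p := p) (R := ℤ_[p]) ℚ_[p]).comp Ψ, ?_, ?_⟩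
  · intro F g
    rw [LinearMap.comp_apply, LinearMap.comp_apply, hΨ F g, coordReduce_coordRep, TwistedQuotient.resScalars_apply]
  · intro h0
    apply hΨ0
    ext F o
    have h1 : coordReduce ℚ_[p] (Ψ F) = 0 := by
      rw [← LinearMap.comp_apply, h0, LinearMap.zero_apply]
    have h2 := coordReduce_padic_injective p (h1.trans (map_zero _).symm)
    rw [h2, LinearMap.zero_apply]

/-- **(I1ℚ) ⟺ (I1⁰)** (and hence ⟺ (I1‴), `tamePrincipalSeriesFunctional_iff`).  BSD is not proved by this.
[cite: SerreLinearRepresentations1977, §15.2] -/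
theorem tamePrincipalSeriesFunctionalRat_iff : TamePrincipalSeriesFunctionalRat ↔ TamePrincipalSeriesFunctional :=
  ⟨tamePrincipalSeriesFunctional_of_rat, tamePrincipalSeriesFunctionalRat_of_integral⟩

/-- **K from modularity, the RATIONAL principal-series input (I1ℚ) and the Ash–Stevens weight exclusion (W‴).**  Conclusion =
the route decl `TwistedPeriodLatticeSaturation` VERBATIM; BSD is not proved by this; K is proved CONDITIONALLY on the three named
hypotheses. [cite: EdixhovenManin1991, §4] [cite: SerreLinearRepresentations1977, §7.2 Prop. 21, §15.2] -/
theorem twistedPeriodLatticeSaturation_of_rat_of_noEtaleWeightEigenQuotient (hnf : exists_isNewformOf)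
    (hrat : TamePrincipalSeriesFunctionalRat) (hW : NoEtaleWeightEigenQuotient) : TwistedPeriodLatticeSaturation :=
  twistedPeriodLatticeSaturation_of_principalSeries_of_noEtaleWeightEigenQuotient hnf
    (tamePrincipalSeriesFunctional_of_rat hrat) hW

/-- **GE11 from its final named inputs (rational form).**  `OrdinaryLowValuationOptimalManinUnitGeEleven` (route decl verbatim)
from modularity, Edixhoven's Kodaira-type theorem, (I1ℚ) and (W‴).  BSD is not proved by this; GE11 is proved CONDITIONALLY on
the four named hypotheses. [cite: EdixhovenManin1991, §4 and Thm. 3] [cite: Stevens1989, Lemma (5.2)] -/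
theorem ordinaryLowValuationOptimalManinUnitGeEleven_of_rat_inputs (hnf : exists_isNewformOf)
    (hEdix : edixhoven_not_dvd_maninConstant_of_kodairaSymbol_ne)
    (hrat : TamePrincipalSeriesFunctionalRat) (hW : NoEtaleWeightEigenQuotient) :
    OrdinaryLowValuationOptimalManinUnitGeEleven :=
  ordinaryLowValuationOptimalManinUnitGeEleven_of_principalSeries_inputs hnf hEdix
    (tamePrincipalSeriesFunctional_of_rat hrat) hW

/-- **(I1ᴷ) ⟺ (I1⁰)**: the geometric, rational and integral forms of the automorphic input agree.  BSD is not proved by this.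
[cite: SerreLinearRepresentations1977, §15.2] -/
theorem tamePrincipalSeriesFunctionalOverField_iff :
    TamePrincipalSeriesFunctionalOverField ↔ TamePrincipalSeriesFunctional :=
  ⟨fun h => tamePrincipalSeriesFunctional_of_rat (tamePrincipalSeriesFunctionalRat_of_field h),
    fun h => tamePrincipalSeriesFunctionalOverField_of_rat (tamePrincipalSeriesFunctionalRat_of_integral h)⟩

/-- **K from modularity, the GEOMETRIC principal-series input (I1ᴷ: over some field `K ⊇ ℚ_p`, e.g. `ℚ̄_p`) and the
Ash–Stevens weight exclusion (W‴).**  Conclusion = the route decl `TwistedPeriodLatticeSaturation` VERBATIM; BSD is not proved by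
this; K is proved CONDITIONALLY on the three named hypotheses. [cite: EdixhovenManin1991, §4]
[cite: SerreLinearRepresentations1977, §7.2 Prop. 21, §15.2] -/
theorem twistedPeriodLatticeSaturation_of_field_of_noEtaleWeightEigenQuotient (hnf : exists_isNewformOf)
    (hK : TamePrincipalSeriesFunctionalOverField) (hW : NoEtaleWeightEigenQuotient) : TwistedPeriodLatticeSaturation :=
  twistedPeriodLatticeSaturation_of_rat_of_noEtaleWeightEigenQuotient hnf (tamePrincipalSeriesFunctionalRat_of_field hK) hW

/-- **GE11 from its final named inputs (geometric form).**  `OrdinaryLowValuationOptimalManinUnitGeEleven` (route decl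
verbatim) from modularity, Edixhoven's Kodaira-type theorem, (I1ᴷ) and (W‴).  BSD is not proved by this; GE11 is proved
CONDITIONALLY on the four named hypotheses. [cite: EdixhovenManin1991, §4 and Thm. 3] [cite: Stevens1989, Lemma (5.2)] -/
theorem ordinaryLowValuationOptimalManinUnitGeEleven_of_field_inputs (hnf : exists_isNewformOf)
    (hEdix : edixhoven_not_dvd_maninConstant_of_kodairaSymbol_ne)
    (hK : TamePrincipalSeriesFunctionalOverField) (hW : NoEtaleWeightEigenQuotient) :
    OrdinaryLowValuationOptimalManinUnitGeEleven :=
  ordinaryLowValuationOptimalManinUnitGeEleven_of_rat_inputs hnf hEdix (tamePrincipalSeriesFunctionalRat_of_field hK) hW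

end KOfPrincipalSeriesFunctional

end Summit.BirchSwinnertonDyer.BirchSwinnertonDyer.Theorems.TeichmullerTwistDescent
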